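import Literature.Topology.FourManifolds.TautFoliationsCollarEssential
import Literature.Topology.FourManifolds.TautFoliationsConePositionEven
import HarnessLib

/-!
# The essential compact contour leaf of the coned fence collar

Topic: the coned fence collar — packaging of (d). For a closed fence of `F` over the unit
interval (horizontals closed at every admissible level) and its collar disc `G` (the fence read
in polar coordinates about `c₀` on `{L/2 ≤ dist(·, c₀)}`), there are a cone position `P` of `G`
with an even mesh `≥ 128` keeping `G` on the outer-collar edges, a generic radius
`R ∈ [15L/16, 31L/32]` and a point `y₀` of the carrier at distance `R` from `c₀` whose leaf in the
contour foliation is **compact**, contained in the wiggly ring `W_R`, and **not image-null as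
soon as the level of `R` is not a null level of the fence**
(`exists_essential_compact_leaf_collar`): the cone position from
`exists_conePosition_collar_ge_even`, the radius from `exists_generic_radius'`, the crossing
enumeration from `exists_crossing_enumeration` (the start is a crossing for an even mesh), the
squares along the ring from `exists_sq_of_consecutive`, and `not_imageNull_of_not_nullLevel`.

* `Foliation.exists_essential_compact_leaf_collar` (**proved**).

All statements are [folklore].
-/

noncomputable section

open Set Filter Metric Topology Function Real
open scoped unitInterval
open Literature.Topology.PlanarFoliations

namespace Literature.Topology.FourManifolds

namespace Foliation

open SquareGrid SquareGrid.Grid SquarePolar ConeSquare CollarRadius Partition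

variable {B : Type*} [NormedAddCommGroup B] [NormedSpace ℝ B] [ProperSpace B] {M : Type*} [TopologicalSpace M] [T2Space M]
  {F : Foliation B M}
variable {Γ : C(I, F.GermSpace)} {τ₀ ε : ℝ} {Φ : I → ℝ → M} {c₀ : ℝ × ℝ} {L : ℝ} {G : ℝ × ℝ → M}

/-- **The essential compact contour leaf of the coned fence collar.** [folklore] -/
theorem exists_essential_compact_leaf_collar (ho : F.IsTransverselyOriented) (hΦ : IsFenceOn F Γ τ₀ ε Φ univ)
    (hcl : ∀ τ ∈ Ioo (τ₀ - ε) (τ₀ + ε), Φ 1 τ = Φ 0 τ) {τ₁ : ℝ} (hτI : uIcc τ₀ τ₁ ⊆ Ioo (τ₀ - ε) (τ₀ + ε)) (h01 : τ₁ ≠ τ₀)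
    (hL : 0 < L) (hGc : Continuous G)
    (hG : ∀ x, L / 2 ≤ dist x c₀ → G x = Φ (angleParam c₀ x) (levelOfParam τ₀ τ₁ (1 - dist x c₀ / L))) :
    ∃ (P : ConePosition F G c₀ hL) (R : ℝ) (y₀ : P.gr.X₀), 15 * L / 16 ≤ R ∧ R ≤ 31 * L / 32 ∧ dist (y₀ : ℝ × ℝ) c₀ = R ∧
      IsCompact ((P.contourFol ho).leaf y₀) ∧ (∀ z ∈ (P.contourFol ho).leaf y₀, (z : ℝ × ℝ) ∈ P.wigglyRing R) ∧
      (¬ hΦ.NullLevel (levelOfParam τ₀ τ₁ (1 - R / L)) → ¬ ImageNull (P.isFoliatedMap_fill ho) y₀) := by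
  -- the cone position with an even mesh `≥ 128`
  obtain ⟨P, hn128, heven, hskelT⟩ := exists_conePosition_collar_ge_even ho hΦ hcl hτI hL hGc hG 128
  have hn32 : 32 ≤ P.n := le_trans (by norm_num) hn128
  -- a generic radius
  obtain ⟨R, hR, hR', hvert, hl₁, hl₂, hRL⟩ := P.exists_generic_radius' hn128
  have hR0 : 0 < R := by linarith
  have hR1 : R ≤ L := by linarith [P.gr.hℓ]
  -- the crossing enumeration
  have h0sk : ringParam c₀ R 0 ∈ P.gr.skeleton := P.ringParam_zero_mem_skeleton heven hR0.le hR1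
  obtain ⟨N, θs, hmono, h0, hlast, hskel, hθ01, hcomplete⟩ := exists_crossing_enumeration P.gr hR0 hl₁ hl₂ h0sk
  have hN : 0 < N := by
    by_contra hN0
    have hN0' : N = 0 := by omega
    subst hN0'
    have : θs 0 = θs (Fin.last 0) := rfl
    rw [h0, hlast] at this
    exact zero_ne_one this
  -- the squares along the ring
  have hlt : ∀ j : Fin N, θs (Fin.castSucc j) < θs j.succ := fun j ↦ hmono (Fin.castSucc_lt_succ (i := j))
  have hno : ∀ j : Fin N, ∀ θ ∈ Ioo (θs (Fin.castSucc j)) (θs j.succ), ringParam c₀ R θ ∉ P.gr.skeleton := by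
    intro j θ hθ hsk
    have hθI : θ ∈ Icc (0 : ℝ) 1 :=
      ⟨(hθ01 _).1.trans hθ.1.le, hθ.2.le.trans (hθ01 _).2⟩
    obtain ⟨i, hi⟩ := hcomplete θ hθI hsk
    subst hi
    have h1 : Fin.castSucc j < i := hmono.lt_iff_lt.1 hθ.1
    have h2 : i < j.succ := hmono.lt_iff_lt.1 hθ.2
    have h1' : (j : ℕ) < (i : ℕ) := h1
    have h2' : (i : ℕ) < (j : ℕ) + 1 := h2
    omega
  have hsq : ∀ j : Fin N, ∃ q, ringParam c₀ R '' Icc (θs (Fin.castSucc j)) (θs j.succ) ⊆ P.gr.sq q := fun j ↦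
    exists_sq_of_consecutive hL P.hn hR0 hR1 (hlt j) (hno j)
  choose Qs hQs using hsq
  -- the base point
  have hWX := P.wigglyRing_subset_X₀ hΦ hcl hτI h01 hG hGc hn32 hskelT hR hvert hRL
  obtain ⟨q₀, hq₀⟩ := (P.gr.mem_skeleton_iff).1 h0sk
  have hy₀W : ringParam c₀ R 0 ∈ P.wigglyRing R :=
    P.mem_wigglyRing_of_mem_sphere hΦ hcl hτI h01 hG hGc hn32 hskelT hR hq₀ (dist_ringParam hR0.le 0)
  have hy₀X : ringParam c₀ R 0 ∈ (P.gr.X₀ : Set (ℝ × ℝ)) := hWX _ hy₀W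
  refine ⟨P, R, ⟨_, hy₀X⟩, hR, hR', dist_ringParam hR0.le 0, ?_, ?_, fun hnot ↦ ?_⟩
  · exact P.isCompact_leaf_of_mem_wigglyRing hΦ hcl hτI h01 hG hGc hn32 hskelT hR ho hvert hRL ⟨_, hy₀X⟩ hy₀W
  · exact P.leaf_subset_wigglyRing hΦ hcl hτI h01 hG hGc hn32 hskelT hR ho hy₀W
  · exact P.not_imageNull_of_not_nullLevel hΦ hcl hτI h01 hG hGc hn32 hskelT hR ho hvert hRL hN hmono h0 hlast hskel
      (Qs := Qs) (fun j ↦ hQs j) hy₀X hnot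

end Foliation

end Literature.Topology.FourManifolds
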